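import Literature.AnabelianGeometry.EtaleTheta.Discharge.Sec2OrbitEmbeddingOuterTransport
import Literature.AnabelianGeometry.EtaleTheta.Discharge.Sec2OrbitEmbeddingCoeff
import HarnessLib

/-!
# [EtTh] Cor 2.8 (i)/(iii): transport of the orbit collections along an ARBITRARY automorphism `Γ` of `Π^tp_C`
# compatible with an automorphism `α` of `Π^tp_X` (`ι ∘ α = Γ ∘ ι`), unit-free and UNIT-CARRYING (proof-only)

S. Mochizuki, *The étale theta function and its Frobenioid-theoretic manifestations* [EtTh], Publ. RIMS **45**
(2009), §2, Cor 2.8 (i)/(iii) PRIMS PDF p.42 («`γ` preserves the property that `η̈^{Θ,ℤ×μ₂}` … be of standard type —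
a property that determines this collection of classes up to multiplication by a root of unity»), Def 2.7 p.41
(«`Π^tp_X/Π^tp_Ÿ = (ℤ × μ₂)`-orbit `η̈^{Θ,ℤ×μ₂}`»), Thm 1.6 (iii) p.24 (bib key `MochizukiEtTh2009`).

PROOF-ONLY companion (0 `def`, 0 `instance`, no new `Prop`; cell abc-iut, layer L2, seat abc-iut-L2-t1 gen 12 —
abc-iut-L2-lead R1354/R1358 KEY «C28I-TRANSPORT F1», VNEXT note N-C28I-2; every input BY NAME).  abc-iut-w6-d051's
`Sec2OrbitEmbeddingOuterTransport` computes the transport of abc-iut-L2-t2's orbit collections `orbitColl` /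
`rootColl` along the conjugation `γ_x` by an element `x ∈ Π^tp_C` (hypothesis `hα : ι (α g) = x·ι g·x⁻¹`) under the
UNIT-FREE rigidity hypothesis `autMap α⁻¹ β⁻¹ η̈^Θ = σ₀·η̈^Θ`.  THIS FILE removes both restrictions:
* §1 bookkeeping for an ARBITRARY topological automorphism `Γ : Π^tp_C ≃ₜ* Π^tp_C` with `ι ∘ α = Γ ∘ ι`
  (`hα : ι (α g) = Γ (ι g)`): stabilities of `Π^tp_Ÿ = T.PiYddtp` and `Π^tp_{Ÿ̲̲}`, `pull (Γ y) = α (pull y)`, and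
  `Γ_Θ⁻¹ ∘ coeffOf = coeffOf ∘ β⁻¹` from `InducesOnTheta Γ Γ_Θ` (`symm_coeffOf_of_induces_comm`);
* §2 classes: `image_classOf_eq_of_comm` — the `(Γ, Γ_Θ)`-transport of `classOf c` is `classOf (autMap α⁻¹ β⁻¹ c)`;
  `classOf_mk_mul` — **the class of a PRODUCT `[f_k]·c` is the twist of `classOf c` by the transported representative
  `transport f_k`** (the currency of abc-iut-L2-t2's `ThetaOrbitData.twist`);
* §3 root classes: `image_rootClassOf_eq_of_comm`;
* §4 collections: **`image_orbitColl_eq_twist_of_unit`** — under the UNIT-CARRYING rigidity hypothesis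
  `autMap α⁻¹ β⁻¹ η̈^Θ = [f_k]·(σ₀·η̈^Θ)` with `[f_k]` a `Π^tp_X`-invariant class (e.g. the Kummer class of a unit of the
  base field: Thm 1.6 (iii) read element-wise through abc-iut-L2-t2's `transport_eq_autMap` and
  `thetaClasses = {k·η̈^Θ}`) the transported orbit collection is the TWIST of the original by `transport f_k`;
  `image_orbitColl_eq_of_comm` / `image_rootColl_eq_of_comm` — the unit-free case (`σ₀·η̈^Θ`): the collections are
  mapped onto themselves, for arbitrary `Γ`.
HONEST FRAMING: [EtTh] is refereed; statements about the TYPED interface only (generic over an `OrbitEmbedding`); the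
rigidity hypotheses stay in hypothesis position, NOT asserted; no side is taken on [IUTchIII] Cor 3.12; typed ≠ proved.
-/

noncomputable section

namespace Literature.AnabelianGeometry.EtaleTheta

open Literature.AnabelianGeometry.SemiGraphs ThetaCovers Literature.IUT.HodgeArakelov

universe u

namespace ThetaSetting.EtaleThetaData.DoubleUnderline.OrbitEmbedding

variable {p : ℕ} [Fact p.Prime] {D : ThetaSetting p} {E : D.EtaleThetaData} {l : ℕ}
  {C : E.DoubleUnderline l} {T : TemperedCoverData.{u} l} (ε : C.OrbitEmbedding T)
  {Γ : T.Gtp ≃ₜ* T.Gtp} {α : D.PiTemp ≃ₜ* D.PiTemp} {β : D.GtpTheta ≃ₜ* D.GtpTheta}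

/-! ## §1. Bookkeeping of a compatible pair `(Γ, α)`: `ι ∘ α = Γ ∘ ι` -/

/-- `ι (α⁻¹ g) = Γ⁻¹ (ι g)` from `ι (α g) = Γ (ι g)`. [cite: MochizukiEtTh2009, Cor 2.8(i) p.42] -/
theorem ι_symm_eq_of_comm (hα : ∀ g, ε.ι (α g) = Γ (ε.ι g)) (g : D.PiTemp) :
    ε.ι (α.symm g) = Γ.symm (ε.ι g) := by
  rw [ContinuousMulEquiv.eq_symm_apply, ← hα, ContinuousMulEquiv.apply_symm_apply]

/-- `Γ` stabilises `T.PiYddtp = ι(Π^tp_Ÿ)` when `α(Π^tp_Ÿ) ⊆ Π^tp_Ÿ`. [cite: MochizukiEtTh2009, Def 2.7 p.41] -/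
theorem mem_PiYddtp_of_comm (hα : ∀ g, ε.ι (α g) = Γ (ε.ι g))
    (hY : ∀ g, g ∈ D.GtpYdd → α g ∈ D.GtpYdd) (y : ↥T.PiYddtp) : Γ (y : T.Gtp) ∈ T.PiYddtp := by
  obtain ⟨g, hg, hgy⟩ := Subgroup.mem_map.1 (ε.map_GtpYdd.ge y.2)
  rw [← hgy]
  change Γ (ε.ι g) ∈ T.PiYddtp
  rw [← hα]
  exact ε.map_GtpYdd.le ⟨α g, hY g hg, rfl⟩

/-- `Γ⁻¹` stabilises `T.PiYddtp` when `α⁻¹(Π^tp_Ÿ) ⊆ Π^tp_Ÿ`. [cite: MochizukiEtTh2009, Def 2.7 p.41] -/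
theorem symm_mem_PiYddtp_of_comm (hα : ∀ g, ε.ι (α g) = Γ (ε.ι g))
    (hY' : ∀ g, g ∈ D.GtpYdd → α.symm g ∈ D.GtpYdd) (y : ↥T.PiYddtp) : Γ.symm (y : T.Gtp) ∈ T.PiYddtp := by
  obtain ⟨g, hg, hgy⟩ := Subgroup.mem_map.1 (ε.map_GtpYdd.ge y.2)
  rw [← hgy]
  change Γ.symm (ε.ι g) ∈ T.PiYddtp
  rw [← ε.ι_symm_eq_of_comm hα]
  exact ε.map_GtpYdd.le ⟨α.symm g, hY' g hg, rfl⟩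

/-- `Γ` stabilises `Π^tp_{Ÿ̲̲} = T.PiYddtp ∩ Π^tp_{X̲̲}` when `α` stabilises `Π^tp_Ÿ` and `Π^tp_{X̲̲} = C.Huu`.
[cite: MochizukiEtTh2009, Def 2.7 p.41] -/
theorem mem_PiYdduu_of_comm (hα : ∀ g, ε.ι (α g) = Γ (ε.ι g))
    (hY : ∀ g, g ∈ D.GtpYdd → α g ∈ D.GtpYdd) (hU : ∀ g, g ∈ C.Huu → α g ∈ C.Huu)
    (g : ↥(T.PiYddtp ⊓ T.tp T.PiXuu)) : Γ (g : T.Gtp) ∈ T.PiYddtp ⊓ T.tp T.PiXuu := by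
  refine Subgroup.mem_inf.2 ⟨ε.mem_PiYddtp_of_comm hα hY ⟨g, (Subgroup.mem_inf.1 g.2).1⟩, ?_⟩
  obtain ⟨v, hv, hvy⟩ := Subgroup.mem_map.1 (ε.map_Huu.ge (Subgroup.mem_inf.1 g.2).2)
  rw [← hvy]
  change Γ (ε.ι v) ∈ T.tp T.PiXuu
  rw [← hα]
  exact ε.map_Huu.le ⟨α v, hU v hv, rfl⟩

/-- `Γ⁻¹` stabilises `Π^tp_{Ÿ̲̲}` when `α⁻¹` stabilises `Π^tp_Ÿ` and `Π^tp_{X̲̲}`. [cite: MochizukiEtTh2009, Def 2.7 p.41] -/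
theorem symm_mem_PiYdduu_of_comm (hα : ∀ g, ε.ι (α g) = Γ (ε.ι g))
    (hY' : ∀ g, g ∈ D.GtpYdd → α.symm g ∈ D.GtpYdd) (hU' : ∀ g, g ∈ C.Huu → α.symm g ∈ C.Huu)
    (g : ↥(T.PiYddtp ⊓ T.tp T.PiXuu)) : Γ.symm (g : T.Gtp) ∈ T.PiYddtp ⊓ T.tp T.PiXuu := by
  refine Subgroup.mem_inf.2 ⟨ε.symm_mem_PiYddtp_of_comm hα hY' ⟨g, (Subgroup.mem_inf.1 g.2).1⟩, ?_⟩
  obtain ⟨v, hv, hvy⟩ := Subgroup.mem_map.1 (ε.map_Huu.ge (Subgroup.mem_inf.1 g.2).2)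
  rw [← hvy]
  change Γ.symm (ε.ι v) ∈ T.tp T.PiXuu
  rw [← ε.ι_symm_eq_of_comm hα]
  exact ε.map_Huu.le ⟨α.symm v, hU' v hv, rfl⟩

/-- `ι⁻¹` along a compatible pair: `pull (Γ y) = α (pull y)`. [cite: MochizukiEtTh2009, Def 2.7 p.41] -/
theorem pull_of_comm (hα : ∀ g, ε.ι (α g) = Γ (ε.ι g))
    (hY : ∀ g, g ∈ D.GtpYdd → α g ∈ D.GtpYdd) (y : ↥T.PiYddtp) (hy : Γ (y : T.Gtp) ∈ T.PiYddtp) :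
    ε.pull ⟨Γ (y : T.Gtp), hy⟩ = ⟨α (ε.pull y : D.PiTemp), hY _ (ε.pull y).2⟩ := by
  apply Subtype.ext
  apply ε.injective_ι
  change ε.ι (ε.pull ⟨Γ (y : T.Gtp), hy⟩ : D.PiTemp) = ε.ι (α (ε.pull y : D.PiTemp))
  rw [hα, ε.ι_pull, ε.ι_pull]

/-- If `Γ_Θ` is INDUCED (`ThetaOrbitData.InducesOnTheta`) by `Γ` on the cyclotome `ι(toTheta⁻¹Δ_Θ)/ι(Ker toTheta) ≅ Δ_Θ`,
then `Γ_Θ⁻¹ ∘ coeffOf = coeffOf ∘ β⁻¹` on `Δ_Θ` (the form of abc-iut-w6-d049's `symm_coeffOf_of_induces_outer` for an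
arbitrary compatible pair). [cite: MochizukiEtTh2009, Cor 2.8(i) p.42] -/
theorem symm_coeffOf_of_induces_comm (hC : D.Compat) (hS : D.Sec2Hyps) [hb : ε.bot.Normal]
    (hα : ∀ g, ε.ι (α g) = Γ (ε.ι g)) (hβ : ∀ g, β (D.toTheta g) = D.toTheta (α g))
    (hΔ' : ∀ a, a ∈ D.DeltaTheta → β.symm a ∈ D.DeltaTheta) (ΓΘ : ε.Coeff ≃* ε.Coeff)
    (h : (ThetaOrbitData.ofEmbedding ε hC hS).InducesOnTheta Γ ΓΘ) (d : ↥D.DeltaTheta) :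
    ΓΘ.symm (ε.coeffOf d) = ε.coeffOf ⟨β.symm d, hΔ' _ d.2⟩ := by
  obtain ⟨hΓ, hind⟩ := h
  have htop : ∀ t : ↥ε.top, Γ (t : T.Gtp) ∈ ε.top := fun t => hΓ.le ⟨t, t.2, rfl⟩
  have hind' : ∀ t : ↥ε.top, ΓΘ (t : ε.Coeff) = ((⟨_, htop t⟩ : ↥ε.top) : ε.Coeff) := fun t => hind t
  have hsymm : ∀ t, t ∈ ε.top → Γ.symm t ∈ ε.top := fun t ht => by
    obtain ⟨t', ht', htt'⟩ := Subgroup.mem_map.1 (hΓ.ge ht)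
    rw [← htt']
    change Γ.symm (Γ t') ∈ ε.top
    rw [ContinuousMulEquiv.symm_apply_apply]
    exact ht'
  have hmem : ε.ι (α.symm (lift d)) ∈ ε.top := by
    rw [ε.ι_symm_eq_of_comm hα]
    exact hsymm _ (ε.ι_lift_mem_top d)
  rw [MulEquiv.symm_apply_eq]
  calc ε.coeffOf d = ((⟨ε.ι (lift d), ε.ι_lift_mem_top d⟩ : ↥ε.top) : ε.Coeff) := rfl
    _ = ((⟨Γ (ε.ι (α.symm (lift d))), htop ⟨_, hmem⟩⟩ : ↥ε.top) : ε.Coeff) := by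
        congr 1; apply Subtype.ext
        show ε.ι (lift d) = Γ (ε.ι (α.symm (lift d)))
        rw [ε.ι_symm_eq_of_comm hα, ContinuousMulEquiv.apply_symm_apply]
    _ = ΓΘ (((⟨ε.ι (α.symm (lift d)), hmem⟩ : ↥ε.top) : ε.Coeff)) := (hind' ⟨_, hmem⟩).symm
    _ = ΓΘ (ε.coeffOf ⟨β.symm d, hΔ' _ d.2⟩) := by
        congr 1
        exact (ε.coeffOf_eq_mk (by rw [← symm_toTheta_eq hβ, toTheta_lift]) hmem).symm

/-! ## §2. Classes: transport along `(Γ, Γ_Θ)` and the twist by a unit -/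

/-- **Transport on representatives = `autCocycle α⁻¹ β⁻¹`** for a compatible pair: for a cocycle `f` on `Π^tp_Ÿ` and
`Γ_Θ⁻¹ ∘ coeffOf = coeffOf ∘ β⁻¹`, `Γ_Θ⁻¹(F(Γ y)) = (transport (autCocycle α⁻¹ β⁻¹ f))(y)`, `F = transport f`.
[cite: MochizukiEtTh2009, Cor 2.8(iii) p.42] -/
theorem symm_transport_of_comm [hb : ε.bot.Normal]
    (hα : ∀ g, ε.ι (α g) = Γ (ε.ι g)) (hβ : ∀ g, β (D.toTheta g) = D.toTheta (α g))
    (hΔ' : ∀ a, a ∈ D.DeltaTheta → β.symm a ∈ D.DeltaTheta)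
    (hY : ∀ g, g ∈ D.GtpYdd → α g ∈ D.GtpYdd) (ΓΘ : ε.Coeff ≃* ε.Coeff)
    (hΘ : ∀ d : ↥D.DeltaTheta, ΓΘ.symm (ε.coeffOf d) = ε.coeffOf ⟨β.symm d, hΔ' _ d.2⟩)
    (f : ↥(contCocycles D.toTheta D.DeltaTheta D.GtpYdd)) (y : ↥T.PiYddtp)
    (hy : Γ (y : T.Gtp) ∈ T.PiYddtp) :
    ΓΘ.symm (ε.transport f.1 ⟨_, hy⟩) =
      ε.transport (ContH1Aut.autCocycle D.toTheta D.DeltaTheta α.symm β.symm (symm_toTheta_eq hβ) hΔ'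
        (H := D.GtpYdd) (H' := D.GtpYdd) hY f).1 y := by
  have hAB : ε.pull ⟨_, hy⟩ = ⟨α.symm.symm (ε.pull y : D.PiTemp), hY _ (ε.pull y).2⟩ :=
    ε.pull_of_comm hα hY y hy
  show ΓΘ.symm (ε.coeffOf (f.1 (ε.pull ⟨_, hy⟩))) =
    ε.coeffOf ((ContH1Aut.autCocycle D.toTheta D.DeltaTheta α.symm β.symm (symm_toTheta_eq hβ) hΔ'
        (H := D.GtpYdd) (H' := D.GtpYdd) hY f).1 (ε.pull y))
  rw [hΘ, hAB]
  congr 1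

/-- **The transported class is the class of `autMap α⁻¹ β⁻¹ c`** along a compatible pair: the image of `classOf c`
under `F ↦ Γ_Θ⁻¹ ∘ F ∘ Γ` is `classOf (autMap α⁻¹ β⁻¹ c)`. [cite: MochizukiEtTh2009, Cor 2.8(iii) p.42] -/
theorem image_classOf_eq_of_comm [hb : ε.bot.Normal]
    (hα : ∀ g, ε.ι (α g) = Γ (ε.ι g)) (hβ : ∀ g, β (D.toTheta g) = D.toTheta (α g))
    (hΔ : ∀ a, a ∈ D.DeltaTheta → β a ∈ D.DeltaTheta) (hΔ' : ∀ a, a ∈ D.DeltaTheta → β.symm a ∈ D.DeltaTheta)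
    (hY : ∀ g, g ∈ D.GtpYdd → α g ∈ D.GtpYdd) (hY' : ∀ g, g ∈ D.GtpYdd → α.symm g ∈ D.GtpYdd)
    (ΓΘ : ε.Coeff ≃* ε.Coeff)
    (hΘ : ∀ d : ↥D.DeltaTheta, ΓΘ.symm (ε.coeffOf d) = ε.coeffOf ⟨β.symm d, hΔ' _ d.2⟩)
    (hmem : ∀ y : ↥T.PiYddtp, Γ (y : T.Gtp) ∈ T.PiYddtp) (c : D.H1 D.GtpYdd) :
    (fun F : ↥T.PiYddtp → ε.Coeff => fun y : ↥T.PiYddtp => ΓΘ.symm (F ⟨_, hmem y⟩)) '' ε.classOf c =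
      ε.classOf (ContH1Aut.autMap D.toTheta D.DeltaTheta α.symm β.symm (symm_toTheta_eq hβ) hΔ'
        (H := D.GtpYdd) (H' := D.GtpYdd) hY c) := by
  have h1 : ContH1Aut.autMap D.toTheta D.DeltaTheta α β hβ hΔ (H := D.GtpYdd) (H' := D.GtpYdd) hY'
      (ContH1Aut.autMap D.toTheta D.DeltaTheta α.symm β.symm (symm_toTheta_eq hβ) hΔ'
        (H := D.GtpYdd) (H' := D.GtpYdd) hY c) = c :=
    ContH1Aut.autMap_symm_autMap_apply D.toTheta D.DeltaTheta α.symm β.symm (symm_toTheta_eq hβ) hβ hΔ' hΔ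
      hY hY' c
  ext F; constructor
  · rintro ⟨_, ⟨f, hf, rfl⟩, rfl⟩
    refine ⟨ContH1Aut.autCocycle D.toTheta D.DeltaTheta α.symm β.symm (symm_toTheta_eq hβ) hΔ'
      (H := D.GtpYdd) (H' := D.GtpYdd) hY f, ?_, ?_⟩
    · rw [← hf]
      exact (ContH1Aut.autMap_mk D.toTheta D.DeltaTheta α.symm β.symm (symm_toTheta_eq hβ) hΔ'
        (H := D.GtpYdd) (H' := D.GtpYdd) hY f).symm
    · funext y
      exact ε.symm_transport_of_comm hα hβ hΔ' hY ΓΘ hΘ f y (hmem y)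
  · rintro ⟨f', hf', rfl⟩
    refine ⟨ε.transport (ContH1Aut.autCocycle D.toTheta D.DeltaTheta α β hβ hΔ (H := D.GtpYdd)
        (H' := D.GtpYdd) hY' f').1,
      ⟨ContH1Aut.autCocycle D.toTheta D.DeltaTheta α β hβ hΔ (H := D.GtpYdd) (H' := D.GtpYdd) hY' f',
        ?_, rfl⟩, ?_⟩
    · calc ContH1.mk _ (ContH1Aut.autCocycle D.toTheta D.DeltaTheta α β hβ hΔ (H := D.GtpYdd)
              (H' := D.GtpYdd) hY' f').2
          = ContH1Aut.autMap D.toTheta D.DeltaTheta α β hβ hΔ (H := D.GtpYdd) (H' := D.GtpYdd) hY'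
              (QuotientGroup.mk f') :=
            (ContH1Aut.autMap_mk D.toTheta D.DeltaTheta α β hβ hΔ (H := D.GtpYdd) (H' := D.GtpYdd)
              hY' f').symm
        _ = ContH1Aut.autMap D.toTheta D.DeltaTheta α β hβ hΔ (H := D.GtpYdd) (H' := D.GtpYdd) hY'
              (ContH1Aut.autMap D.toTheta D.DeltaTheta α.symm β.symm (symm_toTheta_eq hβ) hΔ'
                (H := D.GtpYdd) (H' := D.GtpYdd) hY c) := by
            rw [← hf']; rfl
        _ = c := h1
    · funext y
      show ΓΘ.symm (ε.transport (ContH1Aut.autCocycle D.toTheta D.DeltaTheta α β hβ hΔ (H := D.GtpYdd)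
          (H' := D.GtpYdd) hY' f').1 ⟨_, hmem y⟩) = ε.transport f'.1 y
      rw [ε.symm_transport_of_comm hα hβ hΔ' hY ΓΘ hΘ _ y (hmem y), ContH1Aut.autCocycle_symm_autCocycle]

/-- **The class of a product `[f_k]·c` is the TWIST of `classOf c` by the transported representative `transport f_k`**
(abc-iut-L2-t2's `ThetaOrbitData.twist` currency: `η ↦ η·κ`). [cite: MochizukiEtTh2009, Cor 2.8(i) p.42] -/
theorem classOf_mk_mul [hb : ε.bot.Normal] (fk : ↥(contCocycles D.toTheta D.DeltaTheta D.GtpYdd)) (c : D.H1 D.GtpYdd) :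
    ε.classOf ((ContH1.mk fk.1 fk.2 : D.H1 D.GtpYdd) * c) =
      (fun F : ↥T.PiYddtp → ε.Coeff => fun y : ↥T.PiYddtp => F y * ε.transport fk.1 y) '' ε.classOf c := by
  have hmul : ∀ (f : ↥(contCocycles D.toTheta D.DeltaTheta D.GtpYdd)) (y : ↥T.PiYddtp),
      ε.transport (fk * f).1 y = ε.transport f.1 y * ε.transport fk.1 y := fun f y => by
    show ε.coeffOf ((fk * f).1 (ε.pull y)) = ε.coeffOf (f.1 (ε.pull y)) * ε.coeffOf (fk.1 (ε.pull y))
    rw [← ε.coeffOf_mul]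
    congr 1
    change fk.1 (ε.pull y) * f.1 (ε.pull y) = f.1 (ε.pull y) * fk.1 (ε.pull y)
    exact Subtype.ext (D.ker_thetaToEll_comm _ (fk.1 (ε.pull y)).2 _ (f.1 (ε.pull y)).2)
  ext F; constructor
  · rintro ⟨g, hg, rfl⟩
    refine ⟨ε.transport (fk⁻¹ * g).1, ⟨fk⁻¹ * g, ?_, rfl⟩, ?_⟩
    · have : (ContH1.mk (fk⁻¹ * g).1 (fk⁻¹ * g).2 : D.H1 D.GtpYdd) =
          (ContH1.mk fk.1 fk.2 : D.H1 D.GtpYdd)⁻¹ * ContH1.mk g.1 g.2 := rfl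
      rw [this, hg, inv_mul_cancel_left]
    · funext y
      show ε.transport (fk⁻¹ * g).1 y * ε.transport fk.1 y = ε.transport g.1 y
      rw [← hmul, mul_inv_cancel_left]
  · rintro ⟨_, ⟨f, hf, rfl⟩, rfl⟩
    refine ⟨fk * f, ?_, ?_⟩
    · have : (ContH1.mk (fk * f).1 (fk * f).2 : D.H1 D.GtpYdd) =
          (ContH1.mk fk.1 fk.2 : D.H1 D.GtpYdd) * ContH1.mk f.1 f.2 := rfl
      rw [this, hf]
    · funext y
      exact (hmul f y).symm

/-! ## §3. Root classes -/

/-- **The transported root class is the root class of `autMap α⁻¹ β⁻¹ c`** along a compatible pair: on `Π^tp_{Ÿ̲̲}`,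
the image of `rootClassOf c` under `ξ ↦ Γ_Θ⁻¹ ∘ ξ ∘ Γ` is `rootClassOf (autMap α⁻¹ β⁻¹ c)`.
[cite: MochizukiEtTh2009, Cor 2.8(iii) p.42] -/
theorem image_rootClassOf_eq_of_comm [hb : ε.bot.Normal]
    (hα : ∀ g, ε.ι (α g) = Γ (ε.ι g)) (hβ : ∀ g, β (D.toTheta g) = D.toTheta (α g))
    (hΔ : ∀ a, a ∈ D.DeltaTheta → β a ∈ D.DeltaTheta) (hΔ' : ∀ a, a ∈ D.DeltaTheta → β.symm a ∈ D.DeltaTheta)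
    (hY : ∀ g, g ∈ D.GtpYdd → α g ∈ D.GtpYdd) (hY' : ∀ g, g ∈ D.GtpYdd → α.symm g ∈ D.GtpYdd)
    (ΓΘ : ε.Coeff ≃* ε.Coeff)
    (hΘ : ∀ d : ↥D.DeltaTheta, ΓΘ.symm (ε.coeffOf d) = ε.coeffOf ⟨β.symm d, hΔ' _ d.2⟩)
    (hmem : ∀ y : ↥T.PiYddtp, Γ (y : T.Gtp) ∈ T.PiYddtp)
    (hmem' : ∀ g : ↥(T.PiYddtp ⊓ T.tp T.PiXuu), Γ (g : T.Gtp) ∈ T.PiYddtp ⊓ T.tp T.PiXuu)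
    (hinv' : ∀ g : ↥(T.PiYddtp ⊓ T.tp T.PiXuu), Γ.symm (g : T.Gtp) ∈ T.PiYddtp ⊓ T.tp T.PiXuu)
    (c : D.H1 D.GtpYdd) :
    (fun ξ : ↥(T.PiYddtp ⊓ T.tp T.PiXuu) → ε.Coeff => fun g : ↥(T.PiYddtp ⊓ T.tp T.PiXuu) =>
        ΓΘ.symm (ξ ⟨_, hmem' g⟩)) '' ε.rootClassOf c =
      ε.rootClassOf (ContH1Aut.autMap D.toTheta D.DeltaTheta α.symm β.symm (symm_toTheta_eq hβ) hΔ'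
        (H := D.GtpYdd) (H' := D.GtpYdd) hY c) := by
  have hcl := ε.image_classOf_eq_of_comm hα hβ hΔ hΔ' hY hY' ΓΘ hΘ hmem c
  -- the two round trips `Γ (Γ⁻¹ g) = g`, `Γ⁻¹ (Γ g) = g`
  have hrt' : ∀ g : ↥(T.PiYddtp ⊓ T.tp T.PiXuu),
      (⟨Γ.symm ((⟨_, hmem' g⟩ : ↥(T.PiYddtp ⊓ T.tp T.PiXuu)) : T.Gtp), hinv' ⟨_, hmem' g⟩⟩ :
        ↥(T.PiYddtp ⊓ T.tp T.PiXuu)) = g := fun g =>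
    Subtype.ext (by show Γ.symm (Γ (g : T.Gtp)) = g; rw [ContinuousMulEquiv.symm_apply_apply])
  have hrtY : ∀ g : ↥(T.PiYddtp ⊓ T.tp T.PiXuu),
      (⟨Γ ((⟨_, hinv' g⟩ : ↥(T.PiYddtp ⊓ T.tp T.PiXuu)) : T.Gtp),
          hmem ⟨_, (Subgroup.mem_inf.1 (hinv' g)).1⟩⟩ : ↥T.PiYddtp) =
        ⟨g, (Subgroup.mem_inf.1 g.2).1⟩ := fun g =>
    Subtype.ext (by show Γ (Γ.symm (g : T.Gtp)) = g; rw [ContinuousMulEquiv.apply_symm_apply])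
  ext ξ'; constructor
  · rintro ⟨ξ, ⟨F, hF, hpow⟩, rfl⟩
    refine ⟨fun y => ΓΘ.symm (F ⟨_, hmem y⟩), hcl.le ⟨F, hF, rfl⟩, fun g => ?_⟩
    exact (map_pow ΓΘ.symm _ l).symm.trans (congrArg ΓΘ.symm (hpow ⟨_, hmem' g⟩))
  · rintro ⟨F', hF', hpow'⟩
    obtain ⟨F, hF, rfl⟩ := hcl.ge hF'
    refine ⟨fun g => ΓΘ (ξ' ⟨_, hinv' g⟩), ⟨F, hF, fun g => ?_⟩, ?_⟩
    · have h1 := congrArg ΓΘ (hpow' ⟨_, hinv' g⟩)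
      refine (map_pow ΓΘ _ l).symm.trans (h1.trans ?_)
      exact (MulEquiv.apply_symm_apply ΓΘ _).trans (congrArg F (hrtY g))
    · funext g
      exact (MulEquiv.symm_apply_apply ΓΘ _).trans (congrArg ξ' (hrt' g))

/-! ## §4. Orbit collections: the unit-carrying and the unit-free transport -/

/-- **Transport of an orbit collection under UNIT-CARRYING rigidity**: if `autMap α⁻¹ β⁻¹ η̈^Θ = [f_k]·(σ₀·η̈^Θ)` with
`[f_k]` a `Π^tp_X`-invariant class (e.g. the Kummer class of a unit: Thm 1.6 (iii) read element-wise) and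
`s ↦ α⁻¹(s)·σ₀` maps `S` onto `S`, then the `(Γ, Γ_Θ)`-transport of `{classOf (s·η̈^Θ) | s ∈ S}` is its TWIST by the
transported representative `transport f_k` («up to multiplication by [the class of] a unit»).
[cite: MochizukiEtTh2009, Cor 2.8(i) p.42] -/
theorem image_orbitColl_eq_twist_of_unit (hC : D.Compat) [hb : ε.bot.Normal]
    (hα : ∀ g, ε.ι (α g) = Γ (ε.ι g)) (hβ : ∀ g, β (D.toTheta g) = D.toTheta (α g))
    (hΔ : ∀ a, a ∈ D.DeltaTheta → β a ∈ D.DeltaTheta) (hΔ' : ∀ a, a ∈ D.DeltaTheta → β.symm a ∈ D.DeltaTheta)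
    (hY : ∀ g, g ∈ D.GtpYdd → α g ∈ D.GtpYdd) (hY' : ∀ g, g ∈ D.GtpYdd → α.symm g ∈ D.GtpYdd)
    (ΓΘ : ε.Coeff ≃* ε.Coeff)
    (hΘ : ∀ d : ↥D.DeltaTheta, ΓΘ.symm (ε.coeffOf d) = ε.coeffOf ⟨β.symm d, hΔ' _ d.2⟩)
    (hmem : ∀ y : ↥T.PiYddtp, Γ (y : T.Gtp) ∈ T.PiYddtp) {σ₀ : D.PiTemp}
    (fk : ↥(contCocycles D.toTheta D.DeltaTheta D.GtpYdd))
    (hk : ∀ s : D.PiTemp, haveI := hC.GtpYdd_normal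
      ContH1.conj D.toTheta D.DeltaTheta s (ContH1.mk fk.1 fk.2 : D.H1 D.GtpYdd) = ContH1.mk fk.1 fk.2)
    (hη : haveI := hC.GtpYdd_normal
      ContH1Aut.autMap D.toTheta D.DeltaTheta α.symm β.symm (symm_toTheta_eq hβ) hΔ'
          (H := D.GtpYdd) (H' := D.GtpYdd) hY E.etaDd =
        ContH1.mk fk.1 fk.2 * ContH1.conj D.toTheta D.DeltaTheta σ₀ E.etaDd)
    {S : Set D.PiTemp} (h₁ : ∀ s ∈ S, α.symm s * σ₀ ∈ S) (h₂ : ∀ s ∈ S, α (s * σ₀⁻¹) ∈ S) :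
    (fun c => (fun F : ↥T.PiYddtp → ε.Coeff => fun y : ↥T.PiYddtp => ΓΘ.symm (F ⟨_, hmem y⟩)) '' c) ''
        ε.orbitColl hC S =
      (fun c => (fun F : ↥T.PiYddtp → ε.Coeff => fun y : ↥T.PiYddtp => F y * ε.transport fk.1 y) '' c) ''
        ε.orbitColl hC S := by
  haveI := hC.GtpYdd_normal
  have key : ∀ s : D.PiTemp,
      (fun F : ↥T.PiYddtp → ε.Coeff => fun y : ↥T.PiYddtp => ΓΘ.symm (F ⟨_, hmem y⟩)) ''
          ε.classOf (ContH1.conj D.toTheta D.DeltaTheta s E.etaDd) =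
        (fun F : ↥T.PiYddtp → ε.Coeff => fun y : ↥T.PiYddtp => F y * ε.transport fk.1 y) ''
          ε.classOf (ContH1.conj D.toTheta D.DeltaTheta (α.symm s * σ₀) E.etaDd) := fun s => by
    rw [ε.image_classOf_eq_of_comm hα hβ hΔ hΔ' hY hY' ΓΘ hΘ hmem, ContH1Aut.autMap_conj, hη, map_mul, hk,
      ← ContH1.conj_mul_apply, ε.classOf_mk_mul]
  ext c; constructor
  · rintro ⟨_, ⟨s, hs, rfl⟩, rfl⟩
    exact ⟨ε.classOf (ContH1.conj D.toTheta D.DeltaTheta (α.symm s * σ₀) E.etaDd), ⟨α.symm s * σ₀, h₁ s hs, rfl⟩,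
      (key s).symm⟩
  · rintro ⟨_, ⟨s, hs, rfl⟩, rfl⟩
    refine ⟨ε.classOf (ContH1.conj D.toTheta D.DeltaTheta (α (s * σ₀⁻¹)) E.etaDd),
      ⟨α (s * σ₀⁻¹), h₂ s hs, rfl⟩, ?_⟩
    show (fun F : ↥T.PiYddtp → ε.Coeff => fun y : ↥T.PiYddtp => ΓΘ.symm (F ⟨_, hmem y⟩)) ''
        ε.classOf (ContH1.conj D.toTheta D.DeltaTheta (α (s * σ₀⁻¹)) E.etaDd) = _
    rw [key, ContinuousMulEquiv.symm_apply_apply, inv_mul_cancel_right]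

/-- **Transport of an orbit collection under UNIT-FREE rigidity** along an arbitrary compatible pair: if
`autMap α⁻¹ β⁻¹ η̈^Θ = σ₀·η̈^Θ` and `s ↦ α⁻¹(s)·σ₀` maps `S` onto `S`, the collection is mapped onto itself (the form of
abc-iut-w6-d051's `outer_image_orbitColl_eq` for arbitrary `Γ`). [cite: MochizukiEtTh2009, Cor 2.8(iii) p.42] -/
theorem image_orbitColl_eq_of_comm (hC : D.Compat) [hb : ε.bot.Normal]
    (hα : ∀ g, ε.ι (α g) = Γ (ε.ι g)) (hβ : ∀ g, β (D.toTheta g) = D.toTheta (α g))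
    (hΔ : ∀ a, a ∈ D.DeltaTheta → β a ∈ D.DeltaTheta) (hΔ' : ∀ a, a ∈ D.DeltaTheta → β.symm a ∈ D.DeltaTheta)
    (hY : ∀ g, g ∈ D.GtpYdd → α g ∈ D.GtpYdd) (hY' : ∀ g, g ∈ D.GtpYdd → α.symm g ∈ D.GtpYdd)
    (ΓΘ : ε.Coeff ≃* ε.Coeff)
    (hΘ : ∀ d : ↥D.DeltaTheta, ΓΘ.symm (ε.coeffOf d) = ε.coeffOf ⟨β.symm d, hΔ' _ d.2⟩)
    (hmem : ∀ y : ↥T.PiYddtp, Γ (y : T.Gtp) ∈ T.PiYddtp) {σ₀ : D.PiTemp}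
    (hη : haveI := hC.GtpYdd_normal
      ContH1Aut.autMap D.toTheta D.DeltaTheta α.symm β.symm (symm_toTheta_eq hβ) hΔ'
          (H := D.GtpYdd) (H' := D.GtpYdd) hY E.etaDd =
        ContH1.conj D.toTheta D.DeltaTheta σ₀ E.etaDd)
    {S : Set D.PiTemp} (h₁ : ∀ s ∈ S, α.symm s * σ₀ ∈ S) (h₂ : ∀ s ∈ S, α (s * σ₀⁻¹) ∈ S) :
    (fun c => (fun F : ↥T.PiYddtp → ε.Coeff => fun y : ↥T.PiYddtp => ΓΘ.symm (F ⟨_, hmem y⟩)) '' c) ''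
        ε.orbitColl hC S = ε.orbitColl hC S := by
  haveI := hC.GtpYdd_normal
  ext c; constructor
  · rintro ⟨_, ⟨s, hs, rfl⟩, rfl⟩
    refine ⟨α.symm s * σ₀, h₁ s hs, ?_⟩
    show (fun F : ↥T.PiYddtp → ε.Coeff => fun y : ↥T.PiYddtp => ΓΘ.symm (F ⟨_, hmem y⟩)) ''
        ε.classOf (ContH1.conj D.toTheta D.DeltaTheta s E.etaDd) = _
    rw [ε.image_classOf_eq_of_comm hα hβ hΔ hΔ' hY hY' ΓΘ hΘ hmem, ContH1Aut.autMap_conj, hη,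
      ← ContH1.conj_mul_apply]
  · rintro ⟨s, hs, rfl⟩
    refine ⟨ε.classOf (ContH1.conj D.toTheta D.DeltaTheta (α (s * σ₀⁻¹)) E.etaDd),
      ⟨α (s * σ₀⁻¹), h₂ s hs, rfl⟩, ?_⟩
    show (fun F : ↥T.PiYddtp → ε.Coeff => fun y : ↥T.PiYddtp => ΓΘ.symm (F ⟨_, hmem y⟩)) ''
        ε.classOf (ContH1.conj D.toTheta D.DeltaTheta (α (s * σ₀⁻¹)) E.etaDd) = _
    rw [ε.image_classOf_eq_of_comm hα hβ hΔ hΔ' hY hY' ΓΘ hΘ hmem, ContH1Aut.autMap_conj, hη,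
      ← ContH1.conj_mul_apply, ContinuousMulEquiv.symm_apply_apply, inv_mul_cancel_right]

/-- **Transport of a root-orbit collection under UNIT-FREE rigidity** along an arbitrary compatible pair: the
collection `{rootClassOf (s·η̈^Θ) | s ∈ S}` is mapped onto itself (the form of abc-iut-w6-d051's
`outer_image_rootColl_eq` for arbitrary `Γ`). [cite: MochizukiEtTh2009, Cor 2.8(iii) p.42] -/
theorem image_rootColl_eq_of_comm (hC : D.Compat) [hb : ε.bot.Normal]
    (hα : ∀ g, ε.ι (α g) = Γ (ε.ι g)) (hβ : ∀ g, β (D.toTheta g) = D.toTheta (α g))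
    (hΔ : ∀ a, a ∈ D.DeltaTheta → β a ∈ D.DeltaTheta) (hΔ' : ∀ a, a ∈ D.DeltaTheta → β.symm a ∈ D.DeltaTheta)
    (hY : ∀ g, g ∈ D.GtpYdd → α g ∈ D.GtpYdd) (hY' : ∀ g, g ∈ D.GtpYdd → α.symm g ∈ D.GtpYdd)
    (ΓΘ : ε.Coeff ≃* ε.Coeff)
    (hΘ : ∀ d : ↥D.DeltaTheta, ΓΘ.symm (ε.coeffOf d) = ε.coeffOf ⟨β.symm d, hΔ' _ d.2⟩)
    (hmem : ∀ y : ↥T.PiYddtp, Γ (y : T.Gtp) ∈ T.PiYddtp)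
    (hmem' : ∀ g : ↥(T.PiYddtp ⊓ T.tp T.PiXuu), Γ (g : T.Gtp) ∈ T.PiYddtp ⊓ T.tp T.PiXuu)
    (hinv' : ∀ g : ↥(T.PiYddtp ⊓ T.tp T.PiXuu), Γ.symm (g : T.Gtp) ∈ T.PiYddtp ⊓ T.tp T.PiXuu)
    {σ₀ : D.PiTemp}
    (hη : haveI := hC.GtpYdd_normal
      ContH1Aut.autMap D.toTheta D.DeltaTheta α.symm β.symm (symm_toTheta_eq hβ) hΔ'
          (H := D.GtpYdd) (H' := D.GtpYdd) hY E.etaDd =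
        ContH1.conj D.toTheta D.DeltaTheta σ₀ E.etaDd)
    {S : Set D.PiTemp} (h₁ : ∀ s ∈ S, α.symm s * σ₀ ∈ S) (h₂ : ∀ s ∈ S, α (s * σ₀⁻¹) ∈ S) :
    (fun c => (fun ξ : ↥(T.PiYddtp ⊓ T.tp T.PiXuu) → ε.Coeff => fun g : ↥(T.PiYddtp ⊓ T.tp T.PiXuu) =>
        ΓΘ.symm (ξ ⟨_, hmem' g⟩)) '' c) '' ε.rootColl hC S = ε.rootColl hC S := by
  haveI := hC.GtpYdd_normal
  ext c; constructor
  · rintro ⟨_, ⟨s, hs, rfl⟩, rfl⟩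
    refine ⟨α.symm s * σ₀, h₁ s hs, ?_⟩
    show (fun ξ : ↥(T.PiYddtp ⊓ T.tp T.PiXuu) → ε.Coeff => fun g : ↥(T.PiYddtp ⊓ T.tp T.PiXuu) =>
        ΓΘ.symm (ξ ⟨_, hmem' g⟩)) '' ε.rootClassOf (ContH1.conj D.toTheta D.DeltaTheta s E.etaDd) = _
    rw [ε.image_rootClassOf_eq_of_comm hα hβ hΔ hΔ' hY hY' ΓΘ hΘ hmem hmem' hinv', ContH1Aut.autMap_conj,
      hη, ← ContH1.conj_mul_apply]
  · rintro ⟨s, hs, rfl⟩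
    refine ⟨ε.rootClassOf (ContH1.conj D.toTheta D.DeltaTheta (α (s * σ₀⁻¹)) E.etaDd),
      ⟨α (s * σ₀⁻¹), h₂ s hs, rfl⟩, ?_⟩
    show (fun ξ : ↥(T.PiYddtp ⊓ T.tp T.PiXuu) → ε.Coeff => fun g : ↥(T.PiYddtp ⊓ T.tp T.PiXuu) =>
        ΓΘ.symm (ξ ⟨_, hmem' g⟩)) ''
        ε.rootClassOf (ContH1.conj D.toTheta D.DeltaTheta (α (s * σ₀⁻¹)) E.etaDd) = _
    rw [ε.image_rootClassOf_eq_of_comm hα hβ hΔ hΔ' hY hY' ΓΘ hΘ hmem hmem' hinv', ContH1Aut.autMap_conj,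
      hη, ← ContH1.conj_mul_apply, ContinuousMulEquiv.symm_apply_apply, inv_mul_cancel_right]

end ThetaSetting.EtaleThetaData.DoubleUnderline.OrbitEmbedding

end Literature.AnabelianGeometry.EtaleTheta

end
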